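/-
Copyright (c) 2026. All rights reserved.
Released under Apache 2.0 license as described in the file LICENSE.
-/
import Literature.AlgebraicGeometry.Pohlmann1968.MultiquadraticCMFieldNearBentTypes
import Literature.NumberTheory.ComplexMultiplication.DegenerateCMTypesElementaryAbelianPlateauedTypesStabilizer
import HarnessLib

/-!
# Plateaued CM types of a multiquadratic CM field: Mumford–Tate rank `4ⁱ + 1`, the stabiliser criterion
# `|Stab(Φ)|·g ≤ L` for Hazama's equality, and partially-bent CM abelian varieties of every rank `4ⁱ + 1` all of whose
# powers satisfy the Hodge conjecture

FIELD DRESS of the tree's group-level files `DegenerateCMTypesElementaryAbelianPlateauedTypes` (g43-#6) and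
`DegenerateCMTypesElementaryAbelianPlateauedTypesStabilizer` (g43-#7), in the format of the tree's
`MultiquadraticCMFieldNearBentTypes` (g43-#5).  SETTING: `K` a MULTIQUADRATIC CM field (`Gal(K/ℚ)` of exponent `2`,
`[K:ℚ] = 2ᴺ`, `g = [K:ℚ]/2`), `φ₀ : K → ℂ` a base embedding, `ρ` = complex conjugation (tree `conjGal`), a CM type `Φ`
read as the group-level type `T_Φ = {s ∈ Gal(K/ℚ) : φ₀ ∘ s ∈ Φ}` (tree `𝓖[φ₀, Φ]`, `isCMTypeWith_galType`), Kubota RANK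
`Rank(Φ) = rank(T_Φ)` (= the rank of the Mumford–Tate group of any abelian variety of type `(K; Φ)`, tree
`cmTypeRank_eq_typeRank_galType`), `Stab(Φ) = {g : Φg = Φ}` (tree `twistStabilizer`, `|Stab(Φ)| = |Stab(T_Φ)|`), and
for an abelian variety `A` of type `(K; Φ)` (tree `IsCMTypeRealisation`) the HAZAMA–POHLMANN DICTIONARY of the tree:
`2·|Stab(Φ)|·(Rank(Φ) − 1) = [K:ℚ]` iff `Bᵐ(A) ⊗ ℂ = Dᵐ(A) ⊗ ℂ` for all `m`
(`two_mul_natCard_twistStabilizer_mul_eq_iff_forall_hodgeClassSpan_eq`), in which case the Hodge conjecture holds for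
every power `Aⁿ` (`hodgeConjectureFor_pow_of_two_mul_natCard_twistStabilizer_mul_eq`), while `<` produces a rational
`(m,m)`-class on `A` outside `Dᵐ(A) ⊗ ℂ` (`exists_exceptional_of_two_mul_natCard_twistStabilizer_mul_lt`)
[Gordon1999HodgeAVSurvey, Thm. 6.4, §9.2–9.3; Pohlmann1968, Thm. 1].  `Φ` is PLATEAUED OF SQUARED AMPLITUDE `L` when
`Ŝ(χ) = Σ_{s ∈ T_Φ} χ(s)` is `0` or has `Ŝ(χ)² = L` for every odd character `χ` of `Gal(K/ℚ)` (C. Carlet [Carlet2020]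
§6.2.2 Definition 63, in the Boolean dictionary of the tree's census files).  THIS FILE proves:

> **Theorem** (`cmTypeRank_sub_one_mul_eq`, `exists_cmTypeRank_eq_four_pow_add_one`, `exists_plateaued_cmTypeRank_eq_iff`).
> For a plateaued `Φ`: **`(Rank(Φ) − 1)·L = g²`, `L = 4ʲ`, `Rank(Φ) = 4ⁱ + 1`, `[K:ℚ] = 2^{i+j+1}`**; and THE SET OF
> RANKS OF THE PLATEAUED CM TYPES OF `K` IS `{4ⁱ + 1 : 2i + 1 ≤ N}`.
> **Theorem** (`natCard_twistStabilizer_mul_le`, `forall_hodgeClassSpan_eq_iff_natCard_twistStabilizer_mul_eq`,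
> `hodgeConjectureFor_pow_or_exists_exceptional`).  **`|Stab(Φ)|·g ≤ L`, AND FOR EVERY ABELIAN VARIETY `A` OF TYPE
> `(K; Φ)`: `Bᵐ(A) ⊗ ℂ = Dᵐ(A) ⊗ ℂ` FOR ALL `m` IFF `|Stab(Φ)|·g = L`** — then the Hodge conjecture holds for every power
> `Aⁿ`; otherwise (`|Stab(Φ)|·g < L`) `A` carries an exceptional Hodge class.  A bent `Φ` (`L = g`) has `|Stab(Φ)| = 1`,
> `A` simple, all powers satisfy the Hodge conjecture (`isSimple_and_hodgeConjectureFor_pow_of_forall_sq_eq`).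
> **Theorem** (`exists_plateaued_natCard_twistStabilizer_eq`, `exists_plateaued_hodgeConjectureFor_pow`, THE
> PARTIALLY-BENT CM TYPES).  **For `[K:ℚ] = 2ᴺ` and every `i` with `2i + 1 ≤ N` there is a plateaued CM type `Φ` of
> `K` of rank `4ⁱ + 1` with `|Stab(Φ)| = 2^{N−1−2i}` and `2·|Stab(Φ)|·(Rank(Φ) − 1) = [K:ℚ]`; every abelian variety of
> type `(K; Φ)` — of dimension `2ᴺ⁻¹`, Mumford–Tate rank `4ⁱ + 1`, not simple when `2i + 1 < N` — satisfies the Hodge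
> conjecture together with all its powers.**
> **Theorem** (`hodgeConjectureFor_pow_of_finrank_le`).  `[K:ℚ] ≤ 32`, `Φ` plateaued ⟹ the Hodge conjecture for all
> powers of every abelian variety of type `(K; Φ)` (ranks `2, 5, 17`; consistent with the tree's degree-`32` criterion
> «exceptional classes iff `Rank = 11`», `MultiquadraticCMFieldDegreeThirtyTwoExceptionalClasses`).

* §0 dictionary helpers; §1 rank and degree; §2 the stabiliser criterion and the Hodge dichotomy; §3 the
  partially-bent CM types; §4 degree `≤ 32`.

HONEST SCOPE.  Transcriptions of the group-level theorems through the tree's dictionary; the sources print Kubota's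
rank lemma, Shimura's reflex bound, the Hazama–Pohlmann criterion (Gordon's survey) and Carlet's Definitions 62/63,
(6.36); «plateaued CM type», the criterion `|Stab|·g = L` and the existence statement are this file's regrouping.  Not
decided here: whether plateaued types with `|Stab(Φ)|·g < L` exist in a given degree (e.g. primitive near-bent types,
`[K:ℚ] = 64`), and the algebraicity of the exceptional classes.  THEOREMS ONLY: no definition, no named fact, no
instance, no `sorry`.

## References

* [Pohlmann1968] H. Pohlmann, *Algebraic cycles on abelian varieties of complex multiplication type*, Ann. of Math. 88
  (1968), Thm. 1.
* [Gordon1999HodgeAVSurvey] B. B. Gordon, *A survey of the Hodge conjecture for abelian varieties* (1999), Thm. 6.4,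
  §9.2–9.3.
* [Shimura1998] G. Shimura, *Abelian Varieties with Complex Multiplication and Modular Functions*, PUP (1998), §8.1,
  §8.2 Prop. 26, §8.4 Example (1), §32.10.
* [Kubota1965] T. Kubota, *On the field extension by complex multiplication*, Trans. AMS 118 (1965), §2, §4 Lemma 2.
* [Carlet2020] C. Carlet, *Boolean Functions for Cryptography and Coding Theory*, CUP (2020), §6.2.1 Definition 62,
  Proposition 95, (6.36); §6.2.2 Definition 63.
* [White1993SporadicCycles] S. P. White, *Sporadic cycles on CM abelian varieties*, Compositio Math. 88 (1993), §4.
* [Dodson1984] B. Dodson, *The structure of Galois groups of CM-fields*, Trans. AMS 283 (1984), §3.1.1.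

## Provenance

Lane `lit-hodgefound` (Track 2, Layer A3), seat `lit-hodgefound-p10` generation 43, row g43-#8; neighbours cited by
name, nothing restated: `DegenerateCMTypesElementaryAbelianPlateauedTypes` (`typeRank_sub_one_mul_eq`, `card_le`,
`le_card_sq`, `eq_card_iff_forall_sq_eq`, `exists_eq_four_pow`, `exists_plateaued_typeRank_eq_iff`, USED),
`DegenerateCMTypesElementaryAbelianPlateauedTypesStabilizer` (`card_stabilizer_mul_card_le`,
`card_stabilizer_mul_card_eq_iff`, `card_stabilizer_eq_one_of_forall_sq_eq`, `exists_isCMTypeWith_plateaued_card_stabilizer_eq`,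
`two_mul_card_stabilizer_mul_eq_of_card_le`, USED), `MultiquadraticCMFieldNearBentTypes` (format),
`AbelianCMFieldStabilizerExceptionalClasses` (`two_mul_natCard_twistStabilizer_mul_eq_iff_forall_hodgeClassSpan_eq`,
`exists_exceptional_of_two_mul_natCard_twistStabilizer_mul_lt`, USED), `CMTypeRankStabilizerBound`
(`hodgeConjectureFor_pow_of_two_mul_natCard_twistStabilizer_mul_eq`, USED), `AbelianCMFieldStabilizerCharacterCriterion`
(`natCard_twistStabilizer_eq_card_stabilizer`), `SimpleIffPrimitiveCMType` (`isSimple_iff_primitive`),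
`CMTypeEquivalenceClassesCount` (`pattern_primitive_iff_twistStabilizer_eq_bot`), `DegenerateCMTypesCyclicCMFieldTwoOddPrimes`
(`isCMTypeWith_galType`, `cmTypeRank_eq_typeRank_galType`, `exists_cmType_of_isCMTypeWith`),
`NondegenerateCMTypeExistenceAbelianField` (`apply_conjGal_eq`), `SimpleDegenerateCMAbelianVarietiesCompositeDimension`
(`conjGalElt_ne_one`, `card_gal_eq_finrank`), Mathlib `Subgroup.card_eq_one`, `Subgroup.card_bot`.
-/

open scoped BigOperators NumberField IsMulCommutative Classical
open NumberField Module CategoryTheory CategoryTheory.Limits IntermediateField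

namespace Literature.AlgebraicGeometry.Pohlmann1968

namespace MultiquadraticPlateaued

open scoped Literature.NumberTheory.ComplexMultiplication
open Literature.NumberTheory.ComplexMultiplication (twistStabilizer typeRank IsCMTypeWith conjGal
  pattern_primitive_iff_twistStabilizer_eq_bot)
open Literature.NumberTheory.ComplexMultiplication.CyclicCMType.ExponentTwo.PlateauedTypes
  (typeRank_sub_one_mul_eq card_le le_card_sq eq_card_iff_forall_sq_eq exists_eq_four_pow
  exists_plateaued_typeRank_eq_iff)
open Literature.NumberTheory.ComplexMultiplication.CyclicCMType.ExponentTwo.PlateauedTypesStabilizer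
  (card_stabilizer_mul_card_le card_stabilizer_mul_card_eq_iff card_stabilizer_eq_one_of_forall_sq_eq
  exists_isCMTypeWith_plateaued_card_stabilizer_eq two_mul_card_stabilizer_mul_eq_of_card_le)
open Literature.AlgebraicGeometry.Pohlmann1968.CyclicTwoOddPrimes (isCMTypeWith_galType
  cmTypeRank_eq_typeRank_galType exists_cmType_of_isCMTypeWith)
open Literature.AlgebraicGeometry.Motives (CMType AbelianVariety)
open Literature.AlgebraicGeometry.HodgeTheory
open Literature.AlgebraicGeometry.VanGeemen1994 (hodgeClassSpan)
open Literature.Barriers.HodgeConjecture (divisorClassesSpan)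
open Literature.AlgebraicGeometry.ComplexMultiplication (IsCMTypeRealisation isSimple_iff_primitive)

variable {K : Type} [Field K] [NumberField K] [IsCMField K] [IsGalois ℚ K]
  {A : AbelianVariety ℂ} {ι : 𝓞 K →+* End A} {θ : K →+* Module.End ℂ (complexBetti A.X 1)} {L : ℕ}

/-! ## §0 Dictionary helpers -/

section Helpers

omit [IsGalois ℚ K] in
/-- `σ_{ρg} = σ̄_g` under the base embedding. [cite: Shimura1998, §18.2 Lemma (i)] -/
private theorem apply_conjGal_eq_fp (φ₀ : K →+* ℂ) (x : K) :
    φ₀ ((conjGal : K ≃ₐ[ℚ] K) x) = starRingEnd ℂ (φ₀ x) :=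
  AbelianCMFieldExistence.apply_conjGal_eq φ₀ x

/-- The group-level type `T_Φ = {s : σ_s ∈ Φ}` is a CM type of `Gal(K/ℚ)` w.r.t. `ρ` (abelian `K`).
[cite: Shimura1998, §8.1] [cite: Kubota1965, §2] -/
private theorem isCMTypeWith_T_fp (hexp : ∀ g : K ≃ₐ[ℚ] K, g ^ 2 = 1) (φ₀ : K →+* ℂ) (Φ : CMType K) :
    IsCMTypeWith (conjGal : K ≃ₐ[ℚ] K)
      (↑(Finset.univ.filter fun s : K ≃ₐ[ℚ] K => embOf φ₀ s ∈ Φ.1) : Set (K ≃ₐ[ℚ] K)) := by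
  haveI := Multiquadratic.isAbelianGalois_of_forall_sq_eq_one hexp
  exact isCMTypeWith_galType (apply_conjGal_eq_fp φ₀) Φ

omit [IsGalois ℚ K] in
/-- `ρ ≠ 1`. [cite: Shimura1998, §18.2 Lemma (i)] -/
private theorem conjGal_ne_one_fp (φ₀ : K →+* ℂ) : (conjGal : K ≃ₐ[ℚ] K) ≠ 1 :=
  conjGalElt_ne_one (apply_conjGal_eq_fp φ₀)

omit [IsCMField K] in
/-- `|Stab(Φ)| = |Stab(T_Φ)|` (abelian `K`). [cite: Kubota1965, §4 Lemma 2] [cite: Shimura1998, §8.4 Example (1)] -/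
private theorem natCard_eq_fp (hexp : ∀ g : K ≃ₐ[ℚ] K, g ^ 2 = 1) (φ₀ : K →+* ℂ) (Φ : CMType K) :
    Nat.card (twistStabilizer Φ) =
      (Finset.univ.filter fun g : K ≃ₐ[ℚ] K => ∀ t : K ≃ₐ[ℚ] K,
        t * g ∈ (Finset.univ.filter fun s : K ≃ₐ[ℚ] K => embOf φ₀ s ∈ Φ.1) ↔
          t ∈ (Finset.univ.filter fun s : K ≃ₐ[ℚ] K => embOf φ₀ s ∈ Φ.1)).card := by
  haveI := Multiquadratic.isAbelianGalois_of_forall_sq_eq_one hexp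
  exact natCard_twistStabilizer_eq_card_stabilizer φ₀ Φ

/-- `2·|T| = |G|` for a CM type on a finite commutative group. [cite: Shimura1998, §8.1] -/
private theorem two_mul_card_fp {G : Type*} [CommGroup G] [Fintype G] [DecidableEq G] {ρ : G} {T : Finset G}
    (h : IsCMTypeWith ρ (T : Set G)) : 2 * T.card = Fintype.card G := by
  have hmem : ∀ x : G, ρ * x ∈ T ↔ x ∉ T := fun x => by
    have := h.rho_smul_mem_iff x
    simpa only [smul_eq_mul, Finset.mem_coe] using this
  have hρ2 : ρ * ρ = 1 := by
    have := h.invol (1 : G)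
    simpa [smul_eq_mul] using this
  have hinj : Function.Injective fun s : G => ρ * s := fun a b hab => mul_left_cancel hab
  have hc : Tᶜ = T.image fun s => ρ * s := by
    ext x
    rw [Finset.mem_compl, Finset.mem_image]
    constructor
    · intro hx
      refine ⟨ρ * x, (hmem x).2 hx, ?_⟩
      show ρ * (ρ * x) = x
      rw [← mul_assoc, hρ2, one_mul]
    · rintro ⟨s, hs, rfl⟩
      exact fun hx => ((hmem s).1 hx) hs
  have h1 : Tᶜ.card = T.card := by rw [hc, Finset.card_image_of_injective _ hinj]
  have h2 := Finset.card_add_card_compl T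
  omega

/-- `|T_Φ| = g = [K:ℚ]/2`. [cite: Shimura1998, §8.1] -/
private theorem card_T_eq_fp (hexp : ∀ g : K ≃ₐ[ℚ] K, g ^ 2 = 1) (φ₀ : K →+* ℂ) (Φ : CMType K) :
    (Finset.univ.filter fun s : K ≃ₐ[ℚ] K => embOf φ₀ s ∈ Φ.1).card = finrank ℚ K / 2 := by
  haveI := Multiquadratic.isAbelianGalois_of_forall_sq_eq_one hexp
  have h2 := two_mul_card_fp (isCMTypeWith_T_fp hexp φ₀ Φ)
  rw [card_gal_eq_finrank φ₀] at h2
  omega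

end Helpers

/-! ## §1 Rank and degree of a plateaued CM type -/

section Rank

/-- **`(Rank(Φ) − 1)·L = g²` FOR A PLATEAUED CM TYPE OF SQUARED AMPLITUDE `L`** (`g = [K:ℚ]/2`; Kubota: `Rank − 1` =
the number of surviving odd characters, `= g²/L` by Parseval). [cite: Kubota1965, §4 Lemma 2]
[cite: Carlet2020, §6.2.2 Definition 63] -/
theorem cmTypeRank_sub_one_mul_eq (hexp : ∀ g : K ≃ₐ[ℚ] K, g ^ 2 = 1) (φ₀ : K →+* ℂ) (Φ : CMType K)
    (hpl : ∀ χ : AddChar (Additive (K ≃ₐ[ℚ] K)) ℂ, χ (Additive.ofMul (conjGal : K ≃ₐ[ℚ] K)) = -1 →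
      ∑ s ∈ (Finset.univ.filter fun s : K ≃ₐ[ℚ] K => embOf φ₀ s ∈ Φ.1), χ (Additive.ofMul s) = 0 ∨
        (∑ s ∈ (Finset.univ.filter fun s : K ≃ₐ[ℚ] K => embOf φ₀ s ∈ Φ.1), χ (Additive.ofMul s)) ^ 2 = (L : ℂ)) :
    (cmTypeRank Φ - 1) * L = (finrank ℚ K / 2) ^ 2 := by
  haveI := Multiquadratic.isAbelianGalois_of_forall_sq_eq_one hexp
  rw [cmTypeRank_eq_typeRank_galType Φ φ₀, ← card_T_eq_fp hexp φ₀ Φ]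
  exact typeRank_sub_one_mul_eq hexp (isCMTypeWith_T_fp hexp φ₀ Φ) hpl

/-- **`g ≤ L ≤ g²`** — Carlet's «the amplitude `2ʲ` has `j ≥ n/2`», and `Rank ≥ 2`. [cite: Carlet2020, §6.2.2 Definition 63]
[cite: Kubota1965, §4 Lemma 2] -/
theorem finrank_div_two_le (hexp : ∀ g : K ≃ₐ[ℚ] K, g ^ 2 = 1) (φ₀ : K →+* ℂ) (Φ : CMType K)
    (hpl : ∀ χ : AddChar (Additive (K ≃ₐ[ℚ] K)) ℂ, χ (Additive.ofMul (conjGal : K ≃ₐ[ℚ] K)) = -1 →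
      ∑ s ∈ (Finset.univ.filter fun s : K ≃ₐ[ℚ] K => embOf φ₀ s ∈ Φ.1), χ (Additive.ofMul s) = 0 ∨
        (∑ s ∈ (Finset.univ.filter fun s : K ≃ₐ[ℚ] K => embOf φ₀ s ∈ Φ.1), χ (Additive.ofMul s)) ^ 2 = (L : ℂ)) :
    finrank ℚ K / 2 ≤ L ∧ L ≤ (finrank ℚ K / 2) ^ 2 := by
  haveI := Multiquadratic.isAbelianGalois_of_forall_sq_eq_one hexp
  rw [← card_T_eq_fp hexp φ₀ Φ]
  exact ⟨card_le hexp (isCMTypeWith_T_fp hexp φ₀ Φ) hpl, le_card_sq hexp (isCMTypeWith_T_fp hexp φ₀ Φ) hpl⟩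

/-- **`L = g` IFF `Φ` IS BENT** («a plateaued function is bent iff its Walsh transform never vanishes»).
[cite: Carlet2020, §6.2.2 Definition 63] [cite: Kubota1965, §4 Lemma 2] -/
theorem eq_finrank_div_two_iff_forall_sq_eq (hexp : ∀ g : K ≃ₐ[ℚ] K, g ^ 2 = 1) (φ₀ : K →+* ℂ) (Φ : CMType K)
    (hpl : ∀ χ : AddChar (Additive (K ≃ₐ[ℚ] K)) ℂ, χ (Additive.ofMul (conjGal : K ≃ₐ[ℚ] K)) = -1 →
      ∑ s ∈ (Finset.univ.filter fun s : K ≃ₐ[ℚ] K => embOf φ₀ s ∈ Φ.1), χ (Additive.ofMul s) = 0 ∨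
        (∑ s ∈ (Finset.univ.filter fun s : K ≃ₐ[ℚ] K => embOf φ₀ s ∈ Φ.1), χ (Additive.ofMul s)) ^ 2 = (L : ℂ)) :
    L = finrank ℚ K / 2 ↔
      ∀ χ : AddChar (Additive (K ≃ₐ[ℚ] K)) ℂ, χ (Additive.ofMul (conjGal : K ≃ₐ[ℚ] K)) = -1 →
        (∑ s ∈ (Finset.univ.filter fun s : K ≃ₐ[ℚ] K => embOf φ₀ s ∈ Φ.1), χ (Additive.ofMul s)) ^ 2 =
          ((Finset.univ.filter fun s : K ≃ₐ[ℚ] K => embOf φ₀ s ∈ Φ.1).card : ℂ) := by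
  haveI := Multiquadratic.isAbelianGalois_of_forall_sq_eq_one hexp
  rw [← card_T_eq_fp hexp φ₀ Φ]
  exact eq_card_iff_forall_sq_eq hexp (isCMTypeWith_T_fp hexp φ₀ Φ) hpl

/-- **`L = 4ʲ`, `Rank(Φ) = 4ⁱ + 1`, `i ≤ j`, `[K:ℚ] = 2^{i+j+1}` FOR A PLATEAUED CM TYPE** — the Mumford–Tate rank of an
abelian variety with a plateaued CM type is one more than a power of `4`. [cite: Kubota1965, §4 Lemma 2]
[cite: Carlet2020, §6.2.2 Definition 63] -/
theorem exists_cmTypeRank_eq_four_pow_add_one (hexp : ∀ g : K ≃ₐ[ℚ] K, g ^ 2 = 1) (φ₀ : K →+* ℂ) (Φ : CMType K)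
    (hpl : ∀ χ : AddChar (Additive (K ≃ₐ[ℚ] K)) ℂ, χ (Additive.ofMul (conjGal : K ≃ₐ[ℚ] K)) = -1 →
      ∑ s ∈ (Finset.univ.filter fun s : K ≃ₐ[ℚ] K => embOf φ₀ s ∈ Φ.1), χ (Additive.ofMul s) = 0 ∨
        (∑ s ∈ (Finset.univ.filter fun s : K ≃ₐ[ℚ] K => embOf φ₀ s ∈ Φ.1), χ (Additive.ofMul s)) ^ 2 = (L : ℂ)) :
    ∃ i j : ℕ, i ≤ j ∧ L = 4 ^ j ∧ cmTypeRank Φ = 4 ^ i + 1 ∧ finrank ℚ K = 2 ^ (i + j + 1) := by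
  haveI := Multiquadratic.isAbelianGalois_of_forall_sq_eq_one hexp
  rw [cmTypeRank_eq_typeRank_galType Φ φ₀, ← card_gal_eq_finrank φ₀]
  exact exists_eq_four_pow hexp (isCMTypeWith_T_fp hexp φ₀ Φ) hpl

/-- **THE RANKS OF THE PLATEAUED CM TYPES OF `K` (`[K:ℚ] = 2ᴺ`) ARE EXACTLY THE `4ⁱ + 1` WITH `2i + 1 ≤ N`** (the
group-level types of the tree are realised by CM types of `K`, tree `exists_cmType_of_isCMTypeWith`).
[cite: Kubota1965, §4 Lemma 2] [cite: Carlet2020, §6.2.2 Definition 63 and §6.2.1 (6.36)] [cite: Shimura1998, §8.1] -/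
theorem exists_plateaued_cmTypeRank_eq_iff (hexp : ∀ g : K ≃ₐ[ℚ] K, g ^ 2 = 1) (φ₀ : K →+* ℂ) {N : ℕ}
    (hK : finrank ℚ K = 2 ^ N) (r : ℕ) :
    (∃ Φ : CMType K,
      (∃ L : ℕ, ∀ χ : AddChar (Additive (K ≃ₐ[ℚ] K)) ℂ, χ (Additive.ofMul (conjGal : K ≃ₐ[ℚ] K)) = -1 →
        ∑ s ∈ (Finset.univ.filter fun s : K ≃ₐ[ℚ] K => embOf φ₀ s ∈ Φ.1), χ (Additive.ofMul s) = 0 ∨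
          (∑ s ∈ (Finset.univ.filter fun s : K ≃ₐ[ℚ] K => embOf φ₀ s ∈ Φ.1), χ (Additive.ofMul s)) ^ 2 = (L : ℂ)) ∧
      cmTypeRank Φ = r) ↔ ∃ i : ℕ, 2 * i + 1 ≤ N ∧ r = 4 ^ i + 1 := by
  haveI := Multiquadratic.isAbelianGalois_of_forall_sq_eq_one hexp
  have hcard : Fintype.card (K ≃ₐ[ℚ] K) = 2 ^ N := by rw [card_gal_eq_finrank φ₀, hK]
  rw [← exists_plateaued_typeRank_eq_iff hexp (conjGal_ne_one_fp φ₀) hcard r]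
  constructor
  · rintro ⟨Φ, hL, hr⟩
    refine ⟨_, isCMTypeWith_T_fp hexp φ₀ Φ, hL, ?_⟩
    rw [← cmTypeRank_eq_typeRank_galType Φ φ₀]
    exact hr
  · rintro ⟨T, hT, hL, hr⟩
    obtain ⟨Φ, hΦ⟩ := exists_cmType_of_isCMTypeWith (apply_conjGal_eq_fp φ₀) hT
    refine ⟨Φ, ?_, ?_⟩
    · rw [hΦ]
      exact hL
    · rw [cmTypeRank_eq_typeRank_galType Φ φ₀, hΦ]
      exact hr

end Rank

/-! ## §2 The stabiliser criterion and the Hodge dichotomy -/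

section Stabilizer

/-- **`|Stab(Φ)|·g ≤ L` FOR A PLATEAUED CM TYPE** (Shimura's reflex bound `2·|Stab(Φ)|·(Rank(Φ) − 1) ≤ [K:ℚ]` times
`L`, with `(Rank − 1)·L = g²`): the reflex field has degree `[K*:ℚ] = [K:ℚ]/|Stab(Φ)| ≥ [K:ℚ]·g/L`.
[cite: Shimura1998, §32.10] [cite: Kubota1965, §4 Lemma 2] [cite: Carlet2020, §6.2.2 Definition 63] -/
theorem natCard_twistStabilizer_mul_le (hexp : ∀ g : K ≃ₐ[ℚ] K, g ^ 2 = 1) (φ₀ : K →+* ℂ) (Φ : CMType K)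
    (hpl : ∀ χ : AddChar (Additive (K ≃ₐ[ℚ] K)) ℂ, χ (Additive.ofMul (conjGal : K ≃ₐ[ℚ] K)) = -1 →
      ∑ s ∈ (Finset.univ.filter fun s : K ≃ₐ[ℚ] K => embOf φ₀ s ∈ Φ.1), χ (Additive.ofMul s) = 0 ∨
        (∑ s ∈ (Finset.univ.filter fun s : K ≃ₐ[ℚ] K => embOf φ₀ s ∈ Φ.1), χ (Additive.ofMul s)) ^ 2 = (L : ℂ)) :
    Nat.card (twistStabilizer Φ) * (finrank ℚ K / 2) ≤ L := by
  haveI := Multiquadratic.isAbelianGalois_of_forall_sq_eq_one hexp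
  rw [natCard_eq_fp hexp φ₀ Φ, ← card_T_eq_fp hexp φ₀ Φ]
  exact card_stabilizer_mul_card_le hexp (isCMTypeWith_T_fp hexp φ₀ Φ) hpl

/-- **`|Stab(Φ)|·g = L` IFF THE REFLEX BOUND IS ATTAINED, `2·|Stab(Φ)|·(Rank(Φ) − 1) = [K:ℚ]`** (plateaued `Φ`).
[cite: Shimura1998, §32.10] [cite: Kubota1965, §4 Lemma 2] -/
theorem natCard_twistStabilizer_mul_eq_iff (hexp : ∀ g : K ≃ₐ[ℚ] K, g ^ 2 = 1) (φ₀ : K →+* ℂ) (Φ : CMType K)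
    (hpl : ∀ χ : AddChar (Additive (K ≃ₐ[ℚ] K)) ℂ, χ (Additive.ofMul (conjGal : K ≃ₐ[ℚ] K)) = -1 →
      ∑ s ∈ (Finset.univ.filter fun s : K ≃ₐ[ℚ] K => embOf φ₀ s ∈ Φ.1), χ (Additive.ofMul s) = 0 ∨
        (∑ s ∈ (Finset.univ.filter fun s : K ≃ₐ[ℚ] K => embOf φ₀ s ∈ Φ.1), χ (Additive.ofMul s)) ^ 2 = (L : ℂ)) :
    Nat.card (twistStabilizer Φ) * (finrank ℚ K / 2) = L ↔
      2 * Nat.card (twistStabilizer Φ) * (cmTypeRank Φ - 1) = finrank ℚ K := by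
  haveI := Multiquadratic.isAbelianGalois_of_forall_sq_eq_one hexp
  rw [natCard_eq_fp hexp φ₀ Φ, ← card_T_eq_fp hexp φ₀ Φ, cmTypeRank_eq_typeRank_galType Φ φ₀,
    ← card_gal_eq_finrank φ₀]
  exact card_stabilizer_mul_card_eq_iff hexp (isCMTypeWith_T_fp hexp φ₀ Φ) hpl

/-- **`Bᵐ(A) ⊗ ℂ = Dᵐ(A) ⊗ ℂ` FOR ALL `m` IFF `|Stab(Φ)|·g = L`**, for every abelian variety `A` of type `(K; Φ)`, `Φ`
plateaued of squared amplitude `L` (the Hazama–Pohlmann criterion in the amplitude form).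
[cite: Gordon1999HodgeAVSurvey, Thm. 6.4] [cite: Pohlmann1968, Thm. 1] [cite: Shimura1998, §32.10] -/
theorem forall_hodgeClassSpan_eq_iff_natCard_twistStabilizer_mul_eq (hexp : ∀ g : K ≃ₐ[ℚ] K, g ^ 2 = 1)
    (φ₀ : K →+* ℂ) (Φ : CMType K)
    (hpl : ∀ χ : AddChar (Additive (K ≃ₐ[ℚ] K)) ℂ, χ (Additive.ofMul (conjGal : K ≃ₐ[ℚ] K)) = -1 →
      ∑ s ∈ (Finset.univ.filter fun s : K ≃ₐ[ℚ] K => embOf φ₀ s ∈ Φ.1), χ (Additive.ofMul s) = 0 ∨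
        (∑ s ∈ (Finset.univ.filter fun s : K ≃ₐ[ℚ] K => embOf φ₀ s ∈ Φ.1), χ (Additive.ofMul s)) ^ 2 = (L : ℂ))
    (hA : IsCMTypeRealisation Φ A ι θ) :
    (∀ m : ℕ, hodgeClassSpan (finrank ℚ K / 2) A.X m = divisorClassesSpan A.X (finrank ℚ K / 2) m) ↔
      Nat.card (twistStabilizer Φ) * (finrank ℚ K / 2) = L := by
  haveI := Multiquadratic.isAbelianGalois_of_forall_sq_eq_one hexp
  rw [natCard_twistStabilizer_mul_eq_iff hexp φ₀ Φ hpl,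
    two_mul_natCard_twistStabilizer_mul_eq_iff_forall_hodgeClassSpan_eq Φ hA]

/-- **`|Stab(Φ)|·g = L` ⟹ THE HODGE CONJECTURE FOR EVERY POWER `Aⁿ`** of every abelian variety `A` of type `(K; Φ)`
(Hazama's equality case: `Φ` is induced from a nondegenerate type of the reflex field).
[cite: Gordon1999HodgeAVSurvey, Thm. 6.4 and §9.3] [cite: Pohlmann1968, Thm. 1] [cite: Shimura1998, §32.10] -/
theorem hodgeConjectureFor_pow_of_natCard_twistStabilizer_mul_eq (hexp : ∀ g : K ≃ₐ[ℚ] K, g ^ 2 = 1)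
    (φ₀ : K →+* ℂ) (Φ : CMType K)
    (hpl : ∀ χ : AddChar (Additive (K ≃ₐ[ℚ] K)) ℂ, χ (Additive.ofMul (conjGal : K ≃ₐ[ℚ] K)) = -1 →
      ∑ s ∈ (Finset.univ.filter fun s : K ≃ₐ[ℚ] K => embOf φ₀ s ∈ Φ.1), χ (Additive.ofMul s) = 0 ∨
        (∑ s ∈ (Finset.univ.filter fun s : K ≃ₐ[ℚ] K => embOf φ₀ s ∈ Φ.1), χ (Additive.ofMul s)) ^ 2 = (L : ℂ))
    (heq : Nat.card (twistStabilizer Φ) * (finrank ℚ K / 2) = L) (hA : IsCMTypeRealisation Φ A ι θ) (n : ℕ) :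
    HodgeConjectureFor (⨁ fun _ : Fin n => A).dim (⨁ fun _ : Fin n => A).X := by
  haveI := Multiquadratic.isAbelianGalois_of_forall_sq_eq_one hexp
  exact hodgeConjectureFor_pow_of_two_mul_natCard_twistStabilizer_mul_eq Φ
    ((natCard_twistStabilizer_mul_eq_iff hexp φ₀ Φ hpl).1 heq) hA n

/-- **`|Stab(Φ)|·g < L` ⟹ AN EXCEPTIONAL HODGE CLASS ON `A`**: a rational `(m,m)`-class outside `Dᵐ(A) ⊗ ℂ` for some
`m`, on every abelian variety `A` of type `(K; Φ)` (the reflex bound is strict; Kubota–Pohlmann–White).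
[cite: Pohlmann1968, Thm. 1] [cite: White1993SporadicCycles, §4 Theorem 3] [cite: Gordon1999HodgeAVSurvey, Thm. 6.4 and §9.2] -/
theorem exists_exceptional_of_natCard_twistStabilizer_mul_lt (hexp : ∀ g : K ≃ₐ[ℚ] K, g ^ 2 = 1) (φ₀ : K →+* ℂ)
    (Φ : CMType K)
    (hpl : ∀ χ : AddChar (Additive (K ≃ₐ[ℚ] K)) ℂ, χ (Additive.ofMul (conjGal : K ≃ₐ[ℚ] K)) = -1 →
      ∑ s ∈ (Finset.univ.filter fun s : K ≃ₐ[ℚ] K => embOf φ₀ s ∈ Φ.1), χ (Additive.ofMul s) = 0 ∨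
        (∑ s ∈ (Finset.univ.filter fun s : K ≃ₐ[ℚ] K => embOf φ₀ s ∈ Φ.1), χ (Additive.ofMul s)) ^ 2 = (L : ℂ))
    (hlt : Nat.card (twistStabilizer Φ) * (finrank ℚ K / 2) < L) (hA : IsCMTypeRealisation Φ A ι θ) :
    ∃ m : ℕ, ∃ c : complexBetti A.X (2 * m), IsRationalClass c ∧
      IsOfHodgeType (finrank ℚ K / 2) A.X (2 * m) m m c ∧ c ∉ divisorClassesSpan A.X (finrank ℚ K / 2) m := by
  haveI := Multiquadratic.isAbelianGalois_of_forall_sq_eq_one hexp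
  refine exists_exceptional_of_two_mul_natCard_twistStabilizer_mul_lt Φ ?_ hA
  have hle := two_mul_natCard_twistStabilizer_mul_cmTypeRank_sub_one_le Φ
  rcases hle.lt_or_eq with h | h
  · exact h
  · exact absurd ((natCard_twistStabilizer_mul_eq_iff hexp φ₀ Φ hpl).2 h) hlt.ne

/-- **THE DICHOTOMY FOR PLATEAUED CM TYPES.**  For `Φ` plateaued of squared amplitude `L` and any abelian variety `A`
of type `(K; Φ)`: EITHER `|Stab(Φ)|·g = L` and the Hodge conjecture holds for every power `Aⁿ`, OR `|Stab(Φ)|·g < L`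
and `A` carries an exceptional Hodge class. [cite: Gordon1999HodgeAVSurvey, Thm. 6.4, §9.2–9.3] [cite: Shimura1998, §32.10] -/
theorem hodgeConjectureFor_pow_or_exists_exceptional (hexp : ∀ g : K ≃ₐ[ℚ] K, g ^ 2 = 1) (φ₀ : K →+* ℂ)
    (Φ : CMType K)
    (hpl : ∀ χ : AddChar (Additive (K ≃ₐ[ℚ] K)) ℂ, χ (Additive.ofMul (conjGal : K ≃ₐ[ℚ] K)) = -1 →
      ∑ s ∈ (Finset.univ.filter fun s : K ≃ₐ[ℚ] K => embOf φ₀ s ∈ Φ.1), χ (Additive.ofMul s) = 0 ∨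
        (∑ s ∈ (Finset.univ.filter fun s : K ≃ₐ[ℚ] K => embOf φ₀ s ∈ Φ.1), χ (Additive.ofMul s)) ^ 2 = (L : ℂ))
    (hA : IsCMTypeRealisation Φ A ι θ) :
    (Nat.card (twistStabilizer Φ) * (finrank ℚ K / 2) = L ∧
        ∀ n : ℕ, HodgeConjectureFor (⨁ fun _ : Fin n => A).dim (⨁ fun _ : Fin n => A).X) ∨
      (Nat.card (twistStabilizer Φ) * (finrank ℚ K / 2) < L ∧
        ∃ m : ℕ, ∃ c : complexBetti A.X (2 * m), IsRationalClass c ∧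
          IsOfHodgeType (finrank ℚ K / 2) A.X (2 * m) m m c ∧ c ∉ divisorClassesSpan A.X (finrank ℚ K / 2) m) := by
  rcases (natCard_twistStabilizer_mul_le hexp φ₀ Φ hpl).lt_or_eq with hlt | heq
  · exact Or.inr ⟨hlt, exists_exceptional_of_natCard_twistStabilizer_mul_lt hexp φ₀ Φ hpl hlt hA⟩
  · exact Or.inl ⟨heq, hodgeConjectureFor_pow_of_natCard_twistStabilizer_mul_eq hexp φ₀ Φ hpl heq hA⟩

/-- **A BENT CM TYPE: `|Stab(Φ)| = 1`, `A` SIMPLE, AND THE HODGE CONJECTURE FOR EVERY POWER** (bent = nondegenerate: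
`L = g`, `|Stab|·g ≤ g`; simple ⟺ primitive ⟺ `Stab(Φ) = 1`, tree `isSimple_iff_primitive`).
[cite: Shimura1998, §8.2 Prop. 26 and §32.10] [cite: Gordon1999HodgeAVSurvey, Thm. 6.4 and §9.3] [cite: Kubota1965, §4 Lemma 2] -/
theorem isSimple_and_hodgeConjectureFor_pow_of_forall_sq_eq (hexp : ∀ g : K ≃ₐ[ℚ] K, g ^ 2 = 1) (φ₀ : K →+* ℂ)
    (Φ : CMType K)
    (hbent : ∀ χ : AddChar (Additive (K ≃ₐ[ℚ] K)) ℂ, χ (Additive.ofMul (conjGal : K ≃ₐ[ℚ] K)) = -1 →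
      (∑ s ∈ (Finset.univ.filter fun s : K ≃ₐ[ℚ] K => embOf φ₀ s ∈ Φ.1), χ (Additive.ofMul s)) ^ 2 =
        ((Finset.univ.filter fun s : K ≃ₐ[ℚ] K => embOf φ₀ s ∈ Φ.1).card : ℂ))
    (hA : IsCMTypeRealisation Φ A ι θ) :
    Nat.card (twistStabilizer Φ) = 1 ∧ A.IsSimple ∧
      ∀ n : ℕ, HodgeConjectureFor (⨁ fun _ : Fin n => A).dim (⨁ fun _ : Fin n => A).X := by
  haveI := Multiquadratic.isAbelianGalois_of_forall_sq_eq_one hexp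
  have h1 : Nat.card (twistStabilizer Φ) = 1 := by
    rw [natCard_eq_fp hexp φ₀ Φ]
    exact card_stabilizer_eq_one_of_forall_sq_eq hexp (isCMTypeWith_T_fp hexp φ₀ Φ) hbent
  have hpl : ∀ χ : AddChar (Additive (K ≃ₐ[ℚ] K)) ℂ, χ (Additive.ofMul (conjGal : K ≃ₐ[ℚ] K)) = -1 →
      ∑ s ∈ (Finset.univ.filter fun s : K ≃ₐ[ℚ] K => embOf φ₀ s ∈ Φ.1), χ (Additive.ofMul s) = 0 ∨
        (∑ s ∈ (Finset.univ.filter fun s : K ≃ₐ[ℚ] K => embOf φ₀ s ∈ Φ.1), χ (Additive.ofMul s)) ^ 2 =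
          (((Finset.univ.filter fun s : K ≃ₐ[ℚ] K => embOf φ₀ s ∈ Φ.1).card : ℕ) : ℂ) :=
    fun χ hχ => Or.inr (hbent χ hχ)
  have heq : Nat.card (twistStabilizer Φ) * (finrank ℚ K / 2) =
      (Finset.univ.filter fun s : K ≃ₐ[ℚ] K => embOf φ₀ s ∈ Φ.1).card := by
    rw [h1, one_mul, card_T_eq_fp hexp φ₀ Φ]
  refine ⟨h1, ?_, fun n => hodgeConjectureFor_pow_of_natCard_twistStabilizer_mul_eq hexp φ₀ Φ hpl heq hA n⟩
  exact (isSimple_iff_primitive hA).2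
    ((pattern_primitive_iff_twistStabilizer_eq_bot Φ).2 (Subgroup.card_eq_one.1 h1))

end Stabilizer

/-! ## §3 The partially-bent CM types: every rank `4ⁱ + 1`, all powers satisfy the Hodge conjecture -/

section PartiallyBent

/-- **PARTIALLY-BENT CM TYPES OF EVERY RANK `4ⁱ + 1` ATTAINING THE REFLEX BOUND** (`[K:ℚ] = 2ᴺ`, `2i + 1 ≤ N`): a
plateaued CM type `Φ` of `K` of squared amplitude `4^{N−1−i}`, rank `4ⁱ + 1`, with `|Stab(Φ)| = 2^{N−1−2i}` and
`2·|Stab(Φ)|·(Rank(Φ) − 1) = [K:ℚ]` — the group-level tower of the tree (a bent transversal of a subgroup of order `2·4ⁱ`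
followed by `N − 1 − 2i` concatenations) realised by a CM type of `K`; induced from a bent (nondegenerate) type of the
subfield `K^{Stab(Φ)}` of degree `2^{2i+1}`. [cite: Carlet2020, §6.2.1 Definition 62 and (6.36)] [cite: Shimura1998, §8.1 and §32.10]
[cite: Kubota1965, §4 Lemma 2] -/
theorem exists_plateaued_natCard_twistStabilizer_eq (hexp : ∀ g : K ≃ₐ[ℚ] K, g ^ 2 = 1) (φ₀ : K →+* ℂ) {N i : ℕ}
    (hK : finrank ℚ K = 2 ^ N) (hi : 2 * i + 1 ≤ N) :
    ∃ Φ : CMType K,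
      (∀ χ : AddChar (Additive (K ≃ₐ[ℚ] K)) ℂ, χ (Additive.ofMul (conjGal : K ≃ₐ[ℚ] K)) = -1 →
        ∑ s ∈ (Finset.univ.filter fun s : K ≃ₐ[ℚ] K => embOf φ₀ s ∈ Φ.1), χ (Additive.ofMul s) = 0 ∨
          (∑ s ∈ (Finset.univ.filter fun s : K ≃ₐ[ℚ] K => embOf φ₀ s ∈ Φ.1), χ (Additive.ofMul s)) ^ 2 =
            ((4 ^ (N - 1 - i) : ℕ) : ℂ)) ∧
      cmTypeRank Φ = 4 ^ i + 1 ∧ Nat.card (twistStabilizer Φ) = 2 ^ (N - 1 - 2 * i) ∧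
      2 * Nat.card (twistStabilizer Φ) * (cmTypeRank Φ - 1) = finrank ℚ K := by
  haveI := Multiquadratic.isAbelianGalois_of_forall_sq_eq_one hexp
  have hcard : Fintype.card (K ≃ₐ[ℚ] K) = 2 ^ N := by rw [card_gal_eq_finrank φ₀, hK]
  obtain ⟨T, hT, hpl, hr, hS, heq⟩ :=
    exists_isCMTypeWith_plateaued_card_stabilizer_eq hexp (conjGal_ne_one_fp φ₀) hcard hi
  obtain ⟨Φ, hΦ⟩ := exists_cmType_of_isCMTypeWith (apply_conjGal_eq_fp φ₀) hT
  have hrank : cmTypeRank Φ = 4 ^ i + 1 := by rw [cmTypeRank_eq_typeRank_galType Φ φ₀, hΦ]; exact hr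
  have hstab : Nat.card (twistStabilizer Φ) = 2 ^ (N - 1 - 2 * i) := by rw [natCard_eq_fp hexp φ₀ Φ, hΦ]; exact hS
  refine ⟨Φ, ?_, hrank, hstab, ?_⟩
  · rw [hΦ]
    exact hpl
  · rw [hstab, hrank, ← card_gal_eq_finrank φ₀, ← heq, hS, hr]

/-- **CM ABELIAN VARIETIES OF EVERY MUMFORD–TATE RANK `4ⁱ + 1` ALL OF WHOSE POWERS SATISFY THE HODGE CONJECTURE.**
For a multiquadratic CM field `K` of degree `2ᴺ` and every `i` with `2i + 1 ≤ N` there is a CM type `Φ` of `K` of rank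
`4ⁱ + 1` — degenerate as soon as `2i + 1 < N` — such that every abelian variety `A` of type `(K; Φ)` (dimension `2ᴺ⁻¹`)
satisfies the Hodge conjecture together with all its powers `Aⁿ`, and is not simple when `2i + 1 < N`.
[cite: Gordon1999HodgeAVSurvey, Thm. 6.4 and §9.3] [cite: Pohlmann1968, Thm. 1] [cite: Shimura1998, §8.2 Prop. 26 and §32.10]
[cite: Carlet2020, §6.2.1 (6.36)] -/
theorem exists_plateaued_hodgeConjectureFor_pow (hexp : ∀ g : K ≃ₐ[ℚ] K, g ^ 2 = 1) (φ₀ : K →+* ℂ) {N i : ℕ}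
    (hK : finrank ℚ K = 2 ^ N) (hi : 2 * i + 1 ≤ N) :
    ∃ Φ : CMType K, cmTypeRank Φ = 4 ^ i + 1 ∧ Nat.card (twistStabilizer Φ) = 2 ^ (N - 1 - 2 * i) ∧
      ∀ (A : AbelianVariety ℂ) (ι : 𝓞 K →+* End A) (θ : K →+* Module.End ℂ (complexBetti A.X 1)),
        IsCMTypeRealisation Φ A ι θ →
          (∀ n : ℕ, HodgeConjectureFor (⨁ fun _ : Fin n => A).dim (⨁ fun _ : Fin n => A).X) ∧
          (2 * i + 1 < N → ¬ A.IsSimple) := by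
  haveI := Multiquadratic.isAbelianGalois_of_forall_sq_eq_one hexp
  obtain ⟨Φ, -, hr, hS, heq⟩ := exists_plateaued_natCard_twistStabilizer_eq hexp φ₀ hK hi
  refine ⟨Φ, hr, hS, fun A ι θ hA => ⟨fun n => ?_, fun hlt hsimple => ?_⟩⟩
  · exact hodgeConjectureFor_pow_of_two_mul_natCard_twistStabilizer_mul_eq Φ heq hA n
  · -- simple ⟹ primitive ⟹ `Stab(Φ) = 1`, but `|Stab(Φ)| = 2^{N−1−2i} ≥ 2`
    have hbot := (pattern_primitive_iff_twistStabilizer_eq_bot Φ).1 ((isSimple_iff_primitive hA).1 hsimple)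
    have h1 : Nat.card (twistStabilizer Φ) = 1 := by rw [hbot]; exact Subgroup.card_bot
    rw [hS] at h1
    have hd : N - 1 - 2 * i ≠ 0 := by omega
    exact hd (Nat.pow_right_injective (le_refl 2) (h1.trans (pow_zero 2).symm))

end PartiallyBent

/-! ## §4 Degree at most `32` -/

section SmallDegree

/-- **`[K:ℚ] ≤ 32`, `Φ` PLATEAUED ⟹ THE REFLEX BOUND IS ATTAINED** (ranks `2, 5` always attain it, rank `17` in
degree `32` is bent; tree `two_mul_card_stabilizer_mul_eq_of_card_le`). [cite: Shimura1998, §32.10] [cite: Kubota1965, §4 Lemma 2] -/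
theorem two_mul_natCard_twistStabilizer_mul_eq_of_finrank_le (hexp : ∀ g : K ≃ₐ[ℚ] K, g ^ 2 = 1) (φ₀ : K →+* ℂ)
    (Φ : CMType K)
    (hpl : ∀ χ : AddChar (Additive (K ≃ₐ[ℚ] K)) ℂ, χ (Additive.ofMul (conjGal : K ≃ₐ[ℚ] K)) = -1 →
      ∑ s ∈ (Finset.univ.filter fun s : K ≃ₐ[ℚ] K => embOf φ₀ s ∈ Φ.1), χ (Additive.ofMul s) = 0 ∨
        (∑ s ∈ (Finset.univ.filter fun s : K ≃ₐ[ℚ] K => embOf φ₀ s ∈ Φ.1), χ (Additive.ofMul s)) ^ 2 = (L : ℂ))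
    (hK : finrank ℚ K ≤ 32) :
    2 * Nat.card (twistStabilizer Φ) * (cmTypeRank Φ - 1) = finrank ℚ K := by
  haveI := Multiquadratic.isAbelianGalois_of_forall_sq_eq_one hexp
  have hcard : Fintype.card (K ≃ₐ[ℚ] K) ≤ 32 := by rw [card_gal_eq_finrank φ₀]; exact hK
  rw [natCard_eq_fp hexp φ₀ Φ, cmTypeRank_eq_typeRank_galType Φ φ₀, ← card_gal_eq_finrank φ₀]
  exact two_mul_card_stabilizer_mul_eq_of_card_le hexp (isCMTypeWith_T_fp hexp φ₀ Φ) hpl hcard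

/-- **`[K:ℚ] ≤ 32`, `Φ` PLATEAUED ⟹ THE HODGE CONJECTURE FOR EVERY POWER of every abelian variety of type `(K; Φ)`**
(degrees `4, 8, 16, 32`; in degree `32` the plateaued types are those of rank `2, 5, 17`, avoiding the exceptional rank
`11` of the tree's `MultiquadraticCMFieldDegreeThirtyTwoExceptionalClasses`).
[cite: Gordon1999HodgeAVSurvey, Thm. 6.4 and §9.3] [cite: Pohlmann1968, Thm. 1] [cite: Shimura1998, §32.10] -/
theorem hodgeConjectureFor_pow_of_finrank_le (hexp : ∀ g : K ≃ₐ[ℚ] K, g ^ 2 = 1) (φ₀ : K →+* ℂ) (Φ : CMType K)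
    (hpl : ∀ χ : AddChar (Additive (K ≃ₐ[ℚ] K)) ℂ, χ (Additive.ofMul (conjGal : K ≃ₐ[ℚ] K)) = -1 →
      ∑ s ∈ (Finset.univ.filter fun s : K ≃ₐ[ℚ] K => embOf φ₀ s ∈ Φ.1), χ (Additive.ofMul s) = 0 ∨
        (∑ s ∈ (Finset.univ.filter fun s : K ≃ₐ[ℚ] K => embOf φ₀ s ∈ Φ.1), χ (Additive.ofMul s)) ^ 2 = (L : ℂ))
    (hK : finrank ℚ K ≤ 32) (hA : IsCMTypeRealisation Φ A ι θ) (n : ℕ) :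
    HodgeConjectureFor (⨁ fun _ : Fin n => A).dim (⨁ fun _ : Fin n => A).X := by
  haveI := Multiquadratic.isAbelianGalois_of_forall_sq_eq_one hexp
  exact hodgeConjectureFor_pow_of_two_mul_natCard_twistStabilizer_mul_eq Φ
    (two_mul_natCard_twistStabilizer_mul_eq_of_finrank_le hexp φ₀ Φ hpl hK) hA n

end SmallDegree

end MultiquadraticPlateaued

end Literature.AlgebraicGeometry.Pohlmann1968
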